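import Mathlib
import Summits.NavierStokesRegularity.NavierStokesRegularity.Theorems.SubcriticalEnvelopeForwardSourceTailEnvelopeKPFanTransfer
import Summits.NavierStokesRegularity.NavierStokesRegularity.Theorems.SubOnsagerCeilingForwardTailCeilingKPDyadicLowRange
import HarnessLib

/-!
# `SubcriticalEnvelope.ForwardSourceTailEnvelopeKP` (stmt-NavierStokesRegularity-27130) — RUNG: uniform
KP FAN networks at every scale ratio `ε₀ ∈ [9/16, 1]` (file 3 of 3 of the LEAD-SE rung «uniform KP
fan networks», `--supports`; consumer of LEAD SOC's RUNG 4 per KEY-NS #146 (2))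

* `kpFan_coeff_nonneg_of_orthant` — the cruxes' orthant binder forces `w ≥ 0`;
* `kpFanTable_symmetric/_cancelling/_comparable/_inTableClass`, `kpFanTable_diagonal`,
  `kpFanTable_orthant` — the fan networks are KP-proper members of `E₂(R)` (non-zero weights in
  `[2/R, 1]`), so the rung is not vacuous;
* `kpFan_shellBarrier_range` (`ε₀ ∈ [7/10,1]`, via `dyadicRange_shellBarrier`),
  `kpFan_shellBarrier_midRange` (`ε₀ ∈ [31/50,18/25]`, via `dyadicMidRange_shellBarrier`) and
  `kpFan_shellBarrier_lowRange` (`ε₀ ∈ [9/16,31/50]`, via `dyadicLowRange_shellBarrier`, RUNG 4),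
  θ = 101/200, D = 100;
* `kpFanWide_shellBarrierAt : ∀ R, ∀ ε₀ ∈ [9/16,1], ShellBarrierAt R ε₀ (kpFanTable w)` for EVERY `w`;
  `kpFanWide_ceilingAt`; `forwardSourceTailEnvelopeKP_at_kpFan` (the 27130 clause, S = univ — every
  component of a fan is a forward source).

With the permutation-network rung (p640129) the 27130 rung inventory becomes {uniform KP permutation
networks} ∪ {uniform KP fan networks} × [9/16, 1]: balanced branching/merging is harmless at these
ratios.  Scope: UNBALANCED fans (source-dependent shares) do not collapse; they are periodic-chain-like
and need their own regions.

HONEST FRAMING: statements about Tao-type MODEL lattice ODEs (rung TL-M2Break); one architecture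
class, one ratio range; the cruxes are NOT proved; nothing here concerns the Navier–Stokes equations;
NS regularity is NOT advanced.
-/

noncomputable section

-- the sub-problem namespace `NavierStokesRegularity.NavierStokesRegularity` is the tree's layout (D-0017)
set_option linter.dupNamespace false

namespace Summit.NavierStokesRegularity.NavierStokesRegularity.Theorems

open Set
open Literature.Analysis.FluidPDE.TaoCascade
open Summit.NavierStokesRegularity.NavierStokesRegularity.Theorems.SubOnsagerCeiling
open Summit.NavierStokesRegularity.NavierStokesRegularity.Theses


/-! ## §5 The class and the rung on `ε₀ ∈ [9/16, 1]` -/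

/-- **The orthant clause of the cruxes forces non-negative target weights** (test family: a unit
amplitude on the mode `(a, 1)`; shell `2` of the component `i` is fed by `w i · (1+δ)^{5/2}`).
[this file] -/
theorem kpFan_coeff_nonneg_of_orthant {w : Fin 4 → ℝ}
    (hO : ∀ (Y : Fin 4 → ℤ → ℝ → ℝ) (τ : ℝ), (∀ (j : Fin 4) (k : ℤ), 1 ≤ k → 0 ≤ Y j k τ) →
      ∀ δ : ℝ, 0 < δ → ∀ (i : Fin 4) (n : ℤ), 1 ≤ n → Y i n τ = 0 →
      0 ≤ quadTerm δ (kpFanTable w) Y i n τ) (i : Fin 4) : 0 ≤ w i := by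
  set Y : Fin 4 → ℤ → ℝ → ℝ := fun j k _ => if j = 0 ∧ k = 1 then 1 else 0 with hY
  have hYnn : ∀ (j : Fin 4) (k : ℤ), 1 ≤ k → 0 ≤ Y j k 0 := by
    intro j k _; simp only [hY]; split_ifs <;> norm_num
  have hY2 : Y i 2 0 = 0 := by simp [hY]
  have h := hO Y 0 hYnn 1 one_pos i 2 (by norm_num) hY2
  rw [quadTerm_kpFan, hY2, zero_mul, mul_zero, sub_zero] at h
  have hsum : ∑ a, Y a (2 - 1) 0 ^ 2 = 1 := by
    rw [Fin.sum_univ_four]; simp [hY]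
  rw [hsum, mul_one] at h
  have hw : (0 : ℝ) < (1 + 1) ^ ((5 : ℝ) * ((2 : ℤ) - 1) / 2) := by positivity
  exact nonneg_of_mul_nonneg_left (by simpa [mul_comm] using h) hw

/-- The fan network is symmetric (4.2). [this file] -/
theorem kpFanTable_symmetric (w : Fin 4 → ℝ) : IsSymmetricCoeff (kpFanTable w) := by
  intro i₁ i₂ i₃ μ₁ μ₂ μ₃ hμ
  rw [mem_shiftSet_iff] at hμ
  rcases hμ with h | h | h | h <;> simp only [Prod.mk.injEq] at h <;> obtain ⟨rfl, rfl, rfl⟩ := h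
  · rw [kpFanTable_inshell, kpFanTable_inshell]
  · rw [kpFanTable_up1, kpFanTable_up2]
  · rw [kpFanTable_up2, kpFanTable_up1]
  · rw [kpFanTable_feed, kpFanTable_feed]
    by_cases h : i₁ = i₂
    · subst h; simp
    · rw [if_neg h, if_neg (Ne.symm h)]

/-- The fan network is cancelling (4.3). [this file] -/
theorem kpFanTable_cancelling (w : Fin 4 → ℝ) : IsCancellingCoeff (kpFanTable w) := by
  intro i₁ i₂ i₃ μ₁ μ₂ μ₃ hμ
  rw [mem_shiftSet_iff] at hμ
  rcases hμ with h | h | h | h <;> simp only [Prod.mk.injEq] at h <;> obtain ⟨rfl, rfl, rfl⟩ := h <;>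
    simp only [kpFanTable_inshell, kpFanTable_up1, kpFanTable_up2, kpFanTable_feed]
  · norm_num
  · by_cases hP : i₂ = i₃
    · subst hP; simp only [if_true]; ring
    · simp [hP, Ne.symm hP]
  · by_cases hP : i₁ = i₃
    · subst hP; simp only [if_true]; ring
    · simp [hP, Ne.symm hP]
  · by_cases hP : i₁ = i₂
    · subst hP; simp only [if_true]; ring
    · simp [hP, Ne.symm hP]

/-- The fan network is `R`-comparable when every non-zero weight lies in `[2/R, 1]` in modulus.
[this file] -/
theorem kpFanTable_comparable {w : Fin 4 → ℝ} {R : ℝ} (hR : 0 < R)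
    (hc : ∀ a, w a = 0 ∨ (2 / R ≤ |w a| ∧ |w a| ≤ 1)) : IsComparableCoeff R (kpFanTable w) := by
  have key : ∀ a : Fin 4, (|w a| ≤ 1 ∧ (w a = 0 ∨ R⁻¹ ≤ |w a|)) ∧
      (|-(w a / 2)| ≤ 1 ∧ (-(w a / 2) = 0 ∨ R⁻¹ ≤ |-(w a / 2)|)) := by
    intro a
    have hR1 : R⁻¹ ≤ 2 / R := by rw [inv_eq_one_div]; exact div_le_div_of_nonneg_right (by norm_num) hR.le
    rcases hc a with h | ⟨h1, h2⟩
    · simp [h]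
    · refine ⟨⟨h2, Or.inr (hR1.trans h1)⟩, ?_, Or.inr ?_⟩
      · rw [abs_neg, abs_div, abs_two]; linarith
      · rw [abs_neg, abs_div, abs_two]
        have : 2 / R / 2 = R⁻¹ := by rw [inv_eq_one_div]; ring
        linarith [div_le_div_of_nonneg_right h1 (by norm_num : (0:ℝ) ≤ 2)]
  intro i₁ i₂ i₃ μ hμ
  rw [mem_shiftSet_iff] at hμ
  rcases hμ with rfl | rfl | rfl | rfl
  · rw [kpFanTable_inshell]; simp
  · rw [kpFanTable_up1]; split_ifs
    · exact (key i₁).2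
    · simp
  · rw [kpFanTable_up2]; split_ifs
    · exact (key i₂).2
    · simp
  · rw [kpFanTable_feed]; split_ifs
    · exact (key i₃).1
    · simp

/-- **Uniform fan networks lie in `E₂(R)`** when the non-zero weights lie in `[2/R, 1]`. [this file] -/
theorem kpFanTable_inTableClass {w : Fin 4 → ℝ} {R : ℝ} (hR : 0 < R)
    (hc : ∀ a, w a = 0 ∨ (2 / R ≤ |w a| ∧ |w a| ≤ 1)) : InTableClass R (kpFanTable w) :=
  ⟨kpFanTable_symmetric w, kpFanTable_cancelling w, kpFanTable_comparable hR hc⟩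

/-- The fan network has DIAGONAL feed forms (KP proper). [this file] -/
theorem kpFanTable_diagonal (w : Fin 4 → ℝ) :
    ∀ a b i : Fin 4, a ≠ b → kpFanTable w a b i (0, 0, 1) = 0 := by
  intro a b i hab
  rw [kpFanTable_feed, if_neg hab]

/-- The fan network is ORTHANT when `w ≥ 0`. [this file] -/
theorem kpFanTable_orthant {w : Fin 4 → ℝ} (hw : ∀ a, 0 ≤ w a) :
    ∀ (Y : Fin 4 → ℤ → ℝ → ℝ) (τ : ℝ), (∀ (j : Fin 4) (k : ℤ), 1 ≤ k → 0 ≤ Y j k τ) →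
      ∀ δ : ℝ, 0 < δ → ∀ (i : Fin 4) (n : ℤ), 1 ≤ n → Y i n τ = 0 →
      0 ≤ quadTerm δ (kpFanTable w) Y i n τ := by
  intro Y τ _hY δ hδ i n _hn h0
  rw [quadTerm_kpFan, h0, zero_mul, mul_zero, sub_zero]
  have : (0 : ℝ) ≤ (1 + δ) ^ ((5 : ℝ) * (n - 1) / 2) := Real.rpow_nonneg (by linarith) _
  exact mul_nonneg (hw _) (mul_nonneg this (Finset.sum_nonneg fun a _ => sq_nonneg _))

/-- **ν-UNIFORM SHELL BARRIER FOR UNIFORM FAN NETWORKS on `ε₀ ∈ [7/10, 1]`** (`θ = 101/200`,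
`D = 100`, `w ≥ 0`): the transfer applied to ns-soc-p2's `dyadicRange_shellBarrier` (BY NAME).
MODEL lattice statement. [this file] -/
theorem kpFan_shellBarrier_range {w : Fin 4 → ℝ} {ε₀ : ℝ} (hw : ∀ a, 0 ≤ w a)
    (hε : 7 / 10 ≤ ε₀) (hε1 : ε₀ ≤ 1) :
    ∀ ν : ℝ, 0 < ν → ∀ (X₀ : Fin 4 → ℝ) (s : ℝ), 0 < s → ∀ X : Fin 4 → ℤ → ℝ → ℝ,
      (∀ (i : Fin 4) (k : ℤ), X i k 0 = if k = 0 then X₀ i else 0) →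
      (∀ (i : Fin 4) (k : ℤ), k < 0 → ∀ t : ℝ, X i k t = 0) →
      (∃ M : ℝ, ∀ (t : ℝ) (i : Fin 4) (k : ℤ), (1 + (1 + ε₀) ^ ((10 : ℝ) * k)) * |X i k t| ≤ M) →
      (∀ (i : Fin 4) (k : ℤ), Continuous (X i k)) →
      (∀ (i : Fin 4) (k : ℤ), ∀ t ∈ Set.Icc (0 : ℝ) s, HasDerivWithinAt (X i k)
        (quadTerm ε₀ (kpFanTable w) X i k t - ν * (1 + ε₀) ^ ((2 : ℝ) * k) * X i k t)
        (Set.Icc (0 : ℝ) s) t) →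
      (∀ t ∈ Set.Icc (0 : ℝ) s, ∀ (i : Fin 4) (k : ℤ), 1 ≤ k → 0 ≤ X i k t) →
      ∀ t ∈ Set.Icc (0 : ℝ) s, ∀ (i : Fin 4) (k : ℕ),
        (1 + ε₀) ^ (2 * (101 / 200) * (k : ℝ)) * ((1 / 2 : ℝ) * X i (k : ℤ) t ^ 2) ≤
          100 * (∑ j : Fin 4, (1 / 2 : ℝ) * X₀ j ^ 2) := by
  intro ν hν X₀ s hs X hinit hlow hbd hcont hder hnn
  refine kpFan_shellBound_of_chain hw (by linarith) (by norm_num) (fun hW => ?_) hν hs hinit hlow hbd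
    hcont hder hnn
  have hpos : 0 < ∑ j, w j ^ 2 :=
    lt_of_le_of_ne (Finset.sum_nonneg fun j _ => sq_nonneg (w j)) (Ne.symm hW)
  exact dyadicRange_shellBarrier hpos hε hε1
    (α := fun i₁ i₂ i₃ μ => (∑ j, w j ^ 2) * dyadicTable i₁ i₂ i₃ μ) (fun _ _ _ _ => rfl)

/-- **The same on the mid range `ε₀ ∈ [31/50, 18/25]`** (ns-soc-p2's `dyadicMidRange_shellBarrier`
BY NAME). [this file] -/
theorem kpFan_shellBarrier_midRange {w : Fin 4 → ℝ} {ε₀ : ℝ} (hw : ∀ a, 0 ≤ w a)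
    (hε : 31 / 50 ≤ ε₀) (hε1 : ε₀ ≤ 18 / 25) :
    ∀ ν : ℝ, 0 < ν → ∀ (X₀ : Fin 4 → ℝ) (s : ℝ), 0 < s → ∀ X : Fin 4 → ℤ → ℝ → ℝ,
      (∀ (i : Fin 4) (k : ℤ), X i k 0 = if k = 0 then X₀ i else 0) →
      (∀ (i : Fin 4) (k : ℤ), k < 0 → ∀ t : ℝ, X i k t = 0) →
      (∃ M : ℝ, ∀ (t : ℝ) (i : Fin 4) (k : ℤ), (1 + (1 + ε₀) ^ ((10 : ℝ) * k)) * |X i k t| ≤ M) →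
      (∀ (i : Fin 4) (k : ℤ), Continuous (X i k)) →
      (∀ (i : Fin 4) (k : ℤ), ∀ t ∈ Set.Icc (0 : ℝ) s, HasDerivWithinAt (X i k)
        (quadTerm ε₀ (kpFanTable w) X i k t - ν * (1 + ε₀) ^ ((2 : ℝ) * k) * X i k t)
        (Set.Icc (0 : ℝ) s) t) →
      (∀ t ∈ Set.Icc (0 : ℝ) s, ∀ (i : Fin 4) (k : ℤ), 1 ≤ k → 0 ≤ X i k t) →
      ∀ t ∈ Set.Icc (0 : ℝ) s, ∀ (i : Fin 4) (k : ℕ),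
        (1 + ε₀) ^ (2 * (101 / 200) * (k : ℝ)) * ((1 / 2 : ℝ) * X i (k : ℤ) t ^ 2) ≤
          100 * (∑ j : Fin 4, (1 / 2 : ℝ) * X₀ j ^ 2) := by
  intro ν hν X₀ s hs X hinit hlow hbd hcont hder hnn
  refine kpFan_shellBound_of_chain hw (by linarith) (by norm_num) (fun hW => ?_) hν hs hinit hlow hbd
    hcont hder hnn
  have hpos : 0 < ∑ j, w j ^ 2 :=
    lt_of_le_of_ne (Finset.sum_nonneg fun j _ => sq_nonneg (w j)) (Ne.symm hW)
  exact dyadicMidRange_shellBarrier hpos hε hε1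
    (α := fun i₁ i₂ i₃ μ => (∑ j, w j ^ 2) * dyadicTable i₁ i₂ i₃ μ) (fun _ _ _ _ => rfl)

/-- **The same on the low range `ε₀ ∈ [9/16, 31/50]`** (ns-soc-p2's RUNG 4
`dyadicLowRange_shellBarrier` BY NAME). [this file] -/
theorem kpFan_shellBarrier_lowRange {w : Fin 4 → ℝ} {ε₀ : ℝ} (hw : ∀ a, 0 ≤ w a)
    (hε : (9 : ℝ) / 16 ≤ ε₀) (hε1 : ε₀ ≤ (31 : ℝ) / 50) :
    ∀ ν : ℝ, 0 < ν → ∀ (X₀ : Fin 4 → ℝ) (s : ℝ), 0 < s → ∀ X : Fin 4 → ℤ → ℝ → ℝ,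
      (∀ (i : Fin 4) (k : ℤ), X i k 0 = if k = 0 then X₀ i else 0) →
      (∀ (i : Fin 4) (k : ℤ), k < 0 → ∀ t : ℝ, X i k t = 0) →
      (∃ M : ℝ, ∀ (t : ℝ) (i : Fin 4) (k : ℤ), (1 + (1 + ε₀) ^ ((10 : ℝ) * k)) * |X i k t| ≤ M) →
      (∀ (i : Fin 4) (k : ℤ), Continuous (X i k)) →
      (∀ (i : Fin 4) (k : ℤ), ∀ t ∈ Set.Icc (0 : ℝ) s, HasDerivWithinAt (X i k)
        (quadTerm ε₀ (kpFanTable w) X i k t - ν * (1 + ε₀) ^ ((2 : ℝ) * k) * X i k t)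
        (Set.Icc (0 : ℝ) s) t) →
      (∀ t ∈ Set.Icc (0 : ℝ) s, ∀ (i : Fin 4) (k : ℤ), 1 ≤ k → 0 ≤ X i k t) →
      ∀ t ∈ Set.Icc (0 : ℝ) s, ∀ (i : Fin 4) (k : ℕ),
        (1 + ε₀) ^ (2 * (101 / 200) * (k : ℝ)) * ((1 / 2 : ℝ) * X i (k : ℤ) t ^ 2) ≤
          100 * (∑ j : Fin 4, (1 / 2 : ℝ) * X₀ j ^ 2) := by
  intro ν hν X₀ s hs X hinit hlow hbd hcont hder hnn
  refine kpFan_shellBound_of_chain hw (by linarith) (by norm_num) (fun hW => ?_) hν hs hinit hlow hbd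
    hcont hder hnn
  have hpos : 0 < ∑ j, w j ^ 2 :=
    lt_of_le_of_ne (Finset.sum_nonneg fun j _ => sq_nonneg (w j)) (Ne.symm hW)
  exact dyadicLowRange_shellBarrier hpos hε hε1
    (α := fun i₁ i₂ i₃ μ => (∑ j, w j ^ 2) * dyadicTable i₁ i₂ i₃ μ) (fun _ _ _ _ => rfl)

/-- **The rung in the skeletons' binder shape on the LOW-WIDE range**:
`ShellBarrierAt R ε₀ (kpFanTable w)` for every spread `R`, every `ε₀ ∈ [9/16, 1]` and EVERY weight
vector `w` (the orthant binder forces `w ≥ 0`; splits at `31/50` and `18/25`).  MODEL lattice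
statement. [this file] -/
theorem kpFanWide_shellBarrierAt (w : Fin 4 → ℝ) :
    ∀ R : ℝ, ∀ ε₀ : ℝ, (9 : ℝ) / 16 ≤ ε₀ → ε₀ ≤ 1 → ShellBarrierAt R ε₀ (kpFanTable w) := by
  intro R ε₀ hε hε1 _hT hO
  have hw : ∀ a, 0 ≤ w a := kpFan_coeff_nonneg_of_orthant hO
  by_cases hlow : ε₀ ≤ 31 / 50
  · exact ⟨101 / 200, by norm_num, 100, by norm_num, kpFan_shellBarrier_lowRange hw hε hlow⟩
  by_cases hmid : ε₀ ≤ 18 / 25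
  · exact ⟨101 / 200, by norm_num, 100, by norm_num,
      kpFan_shellBarrier_midRange hw (by linarith) hmid⟩
  · exact ⟨101 / 200, by norm_num, 100, by norm_num, kpFan_shellBarrier_range hw (by linarith) hε1⟩

/-- **Tail ceiling for uniform fan networks on `ε₀ ∈ [9/16, 1]`.** [this file] -/
theorem kpFanWide_ceilingAt (w : Fin 4 → ℝ) :
    ∀ R : ℝ, ∀ ε₀ : ℝ, (9 : ℝ) / 16 ≤ ε₀ → ε₀ ≤ 1 → CeilingAt R ε₀ (kpFanTable w) := by
  intro R ε₀ hε hε1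
  exact subOnsagerCeiling_ceilingAt_of_shellBarrierAt (by linarith) (kpFanWide_shellBarrierAt w R ε₀ hε hε1)

/-- **The 27130 clause on the uniform fan networks at every `ε₀ ∈ [9/16, 1]`** (`S = univ`;
`η = 1/100`, window constant uniform in `T` and `ν`).  MODEL lattice statement; the crux 27130 is NOT
proved (one architecture class, one ratio range). [this file] -/
theorem forwardSourceTailEnvelopeKP_at_kpFan (w : Fin 4 → ℝ) :
    ∀ R : ℝ, 1 ≤ R → ∀ ε₀ : ℝ, (9 : ℝ) / 16 ≤ ε₀ → ε₀ ≤ 1 →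
      InTableClass R (kpFanTable w) →
      (∀ (Y : Fin 4 → ℤ → ℝ → ℝ) (τ : ℝ), (∀ (j : Fin 4) (k : ℤ), 1 ≤ k → 0 ≤ Y j k τ) →
        ∀ δ : ℝ, 0 < δ → ∀ (i : Fin 4) (n : ℤ), 1 ≤ n → Y i n τ = 0 →
        0 ≤ quadTerm δ (kpFanTable w) Y i n τ) →
      (∀ a b i : Fin 4, a ≠ b → kpFanTable w a b i (0, 0, 1) = 0) →
      ∃ S : Finset (Fin 4), (∀ i, i ∉ S → ∀ j l : Fin 4, kpFanTable w i j l (0, 0, 1) = 0) ∧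
      ∀ X₀ : Fin 4 → ℝ, ∃ η : ℝ, 0 < η ∧ ∀ T : ℝ, 0 < T → ∃ C : ℝ, ∀ ν : ℝ, 0 < ν →
      ∀ s ∈ Set.Ioc (0 : ℝ) T, ∀ X : Fin 4 → ℤ → ℝ → ℝ,
      (∀ i k, X i k 0 = if k = 0 then X₀ i else 0) →
      (∀ i k, k < 0 → ∀ t, X i k t = 0) →
      (∃ M : ℝ, ∀ (t : ℝ) (i : Fin 4) (k : ℤ), (1 + (1 + ε₀) ^ ((10 : ℝ) * k)) * |X i k t| ≤ M) →
      (∀ i k, Continuous (X i k)) →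
      (∀ i k, ∀ t ∈ Set.Icc (0 : ℝ) s, HasDerivWithinAt (X i k)
        (quadTerm ε₀ (kpFanTable w) X i k t - ν * (1 + ε₀) ^ ((2 : ℝ) * k) * X i k t)
        (Set.Icc 0 s) t) →
      ∀ n N : ℕ, n ≤ N → ∀ t ∈ Set.Icc (0 : ℝ) s,
        ∑ k ∈ Finset.Icc n N, ∑ i ∈ S, (1 / 2) * X i (k : ℤ) t ^ 2 ≤
          C * (1 + ε₀) ^ (-((1 + η) * (n : ℝ))) := by
  intro R _hR ε₀ hε hε1 hα hK _hdiag
  have hε0 : 0 < ε₀ := by linarith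
  obtain ⟨η, hη, C, _hC0, H⟩ :=
    viscousTailEnvelopeOrthant_uniform_of_ceilingAt hε0 hα hK (kpFanWide_ceilingAt w R ε₀ hε hε1)
  refine ⟨Finset.univ, fun i hi => absurd (Finset.mem_univ i) hi, fun X₀ =>
    ⟨η, hη, fun T _hT => ⟨C * (∑ i : Fin 4, (1 / 2 : ℝ) * X₀ i ^ 2),
      fun ν hν s hs X hinit hlow hbd hcont hder n N hnN t ht => ?_⟩⟩⟩
  exact H ν hν X₀ s hs.1 X hinit hlow hbd hcont hder n N hnN t ht

end Summit.NavierStokesRegularity.NavierStokesRegularity.Theorems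

end
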